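import Summits.QuantumFields.BalabanUV.Beta.FP.TorusCompositeObjects
import Summits.QuantumFields.BalabanUV.Beta.FP.NestedStepLawTorusInstance

/-!
# `BalabanUV.Beta.FP.TorusCompositeCovariance` — road «FP» for binder row D1, ROUTE T, the OWNER d1-p3's SPEC-27 «THE (j, m) TORUS CALL FOR m ≥ 2»
# (ask W-FP-19-14 → leaf-02): **(COV-m) ORDER 0 AT EVERY DEPTH — the composite averaging `compRows … (n+1)` against the tower generator matrix
# `towerGen … (n+1)` (leaf-06 `TorusCompositeObjects`): `Q₁₀ · W₀ = [σ_{n+1} • D̄ | 0]` and the top step's `Q₂₀ · (σ • D̄) = 0`** — the `c0 ∕ d0` binders of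
# the composite torus call `FP/NestedStepLawTorusComposite` (#15), by induction on the depth over gan24-leaf-05's one-step MASTER identity

WHAT.  One step (B): `Q₁₀·D₁ = 0` (the rooted averaging kills the fine torus's gauge modes at its comb's residual parameters, (C1)) and `Q₁₀·D₂ =
stepScale·#B·D̄` (it descends the block-constant modes to the coarse torus's gradients, (C2)) — `NestedStepLawTorusInstance.torus_cov₁ ∕ torus_cov₂` over
`TorusGaugeCovariancePairing.perF_bhKStepAt_mul_tgrad_sum` (the MASTER identity paired with a gauge function).  HERE, for the `(n+1)`-level comb tower
below a top torus `M` (`towerTorus`, `compRows`, `towerGen`, `NParam` of leaf-06, imported BY NAME): §1 `rootPt` (the root site `Lc•u + ρ` of the block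
over `u`, [our object]) and the MASTER identity IN MATRIX FORM `Qstep_mul_tgrad_mul`: `Qstep · (D_fine · C) = (stepScale·#B) • D_coarse · C∘rootPt` for
ANY family `C` of gauge functions; §2 the iterated root map `itRoot` ([our object], push-inside recursion as `towerTorus`), `quo (Lc^n) (itRoot u) = u`, and
the COMPOSITE MASTER identity `compRows_mul_tgrad_mul`: `compRows … n · (D_finest · C) = (∏ stepScale·#B) • D_M · C∘itRoot`; §3 leaf-06's top generator
block `tgradBlock M (bigRatio Lc n)` = `D_finest ·` the `Lc^{n+1}`-block indicator (`towerGen_top_eq`; `pboxCongr_coe` is `rfl`, no transport), the indicator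
read at the iterated roots = the column selector (`blockInd_itRoot`), and **`compRows_mul_towerGen_succ`**: `compRows Lc M lev rs (n+1) * towerGen Lc M rs
(n+1) = fromCols (σ_{n+1} • D̄) 0`, `D̄ := tgrad M↾(fields × Res (toSite (rs 0)))` (the (B) `D̄` shape = `towerGen … 0`), `σ_{n+1} = ∏_{i ≤ n} stepScale d Lc
(lev (i+1)) · #B` DISPLAYED (gan24-leaf-05's NORMALISATION note: unnormalised rows, scalars on the right) — lower block by the induction hypothesis and (C1),
top block by the COMPOSITE MASTER identity; plus **`Qtop_mul_smul_tgrad_res`**: the top step's slot rows kill `σ • D̄` ((C1) one level up, `torus_cov₀'`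
shape).  So #15's `c0 ∕ d0` close BY TERM with `Dbar := σ_{n+1} • D̄` (orders 1, 2 — `c1 c2 d1 d2`, the composite insertion jets by the product rule — are the
NEXT file).  STYLE: the depth recursions compose depth-generic STEP lemmas, stated in the tower's own push-inside types, by `exact` (`rfl`-unfolding).
[our object] two bookkeeping defs (`rootPt`, `itRoot`) + [folklore] finite sums ∕ integer division; no `def … : Prop`, nothing cited, 0 sorry.
Nothing of the dictionary ∕ Bałaban's asserted.

HONEST DEPENDENCY (page 1, mandatory): continuum YM on T⁴ ⇐ BetaPertH ∧ nine spine estimates (0/9 proved); BetaPertH ⇐ (D1) ∧ (D4) ∧ CAP+tail;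
G-an2-4 gates asym, D1 and NE2/3/4.  HONEST FRAMING (cell contract, verbatim): «discharging `BetaPertH` makes Bałaban's UV stability UNCONDITIONAL —
a real constructive-QFT result; it is NOT the continuum limit and NOT the Clay problem.»  ABSOLUTE RULE (cell charter, verbatim): «No internally-minted
statement may enter as a cited fact. Every hypothesis is either kernel-proved in this package or a verbatim quotation of a PUBLISHED theorem with page
reference. The manuscript(s) under audit are NOT citable for their own disputed steps — they are the thing under adjudication; programme-internal
(2001/route/tribunal) claims are never citable.»  0 estimates; 0∕4 row-D1 binders; NOT (T-ID), NOT SDF, NOT D1, NOT BetaPertH, NOT continuum, NOT Clay.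
D1 formalisation swarm LEAF PROVER 02 (b2b-balaban-beta-d1-formalise-leaf-02 gen 21), 2026-08-22.  No existing file touched.
-/

noncomputable section

open scoped BigOperators

namespace Summit.QuantumFields.BalabanUV.Beta.FP.TorusCompositeCovariance

open Matrix Finset
open Literature.Probability.LatticeModels (Torus.proj)
open Literature.MathematicalPhysics.QuantumFieldTheory
open Literature.MathematicalPhysics.QuantumFieldTheory.Balaban1983to89
open Literature.MathematicalPhysics.QuantumFieldTheory.Balaban1983to89.Beta
open B5Prop11Plancherel (fine)
open B6Lemma24Torus (pbox mem_pbox wrap wrap_eq_self wrap_congr)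
open AffineAveraging (Site box toSite unitVec)
open LatticeForm (quo)
open OneStepResolventKernel (Fib)
open Summit.QuantumFields.BalabanUV.Beta.BorderedHessian (bhKStepAt stepScale)
open Summit.QuantumFields.BalabanUV.Beta.FP.KernelPeriodisationFib (Idx perF)
open Summit.QuantumFields.BalabanUV.Beta.FP.TorusGaugeCovariance (tdelta tgrad tgrad_inl tgrad_inr sum_mul_tgrad_eq_sum_inl tdelta_congr)
open Summit.QuantumFields.BalabanUV.Beta.FP.TorusGaugeCovariancePairing (wrapPt wrapPt_coe wrapPt_of_mem sum_tdelta_mul perF_bhKStepAt_mul_tgrad_sum)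
open Summit.QuantumFields.BalabanUV.Beta.FP.TorusGaugeCovarianceCoarse (tgradBlock tgradBlock_inl coarsePt coarsePt_coe proj_coarsePt quo_zsmul_add_toSite' tdelta_quo_congr)
open Summit.QuantumFields.BalabanUV.Beta.FP.TorusCombRows (Res)
open Summit.QuantumFields.BalabanUV.Beta.GAN24.FineReadoutCauchyFrame (toSite_mem_range)
open Summit.QuantumFields.BalabanUV.Beta.FP.NestedStepLawTorusInstance (submatrix_field_mul)
open Summit.QuantumFields.BalabanUV.Beta.FP.TorusCompositeObjects

variable {d : ℕ}

/-! ## §1 The root site of a block; the one-step MASTER identity in matrix form -/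

section OneStep

variable (M : Fin (d + 1) → ℕ) [∀ μ, NeZero (M μ)] (Lc : ℕ) [NeZero Lc] {r : Fin (d + 1) → ℕ}

omit [∀ μ, NeZero (M μ)] [NeZero Lc] in
/-- [folklore] the root site `Lc • u + ρ` of the block over a box point `u` lies in the fine box. -/
theorem zsmul_add_toSite_mem_pbox_fine (hr : r ∈ box (d + 1) Lc) (u : ↥(pbox M)) :
    (Lc : ℤ) • (u : Site (d + 1)) + toSite r ∈ pbox (fine Lc M) := by
  have hu := mem_pbox.1 u.2
  refine mem_pbox.2 fun i => ?_
  obtain ⟨h0, h1⟩ := hu i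
  obtain ⟨hr0, hr1⟩ := toSite_mem_range hr i
  refine ⟨?_, ?_⟩
  · simp only [Pi.add_apply, Pi.smul_apply, smul_eq_mul]; positivity
  · simp only [Pi.add_apply, Pi.smul_apply, smul_eq_mul, fine, Nat.cast_mul]
    have h2 : (u : Site (d + 1)) i + 1 ≤ (M i : ℤ) := h1
    nlinarith

/-- [our object — bookkeeping] **THE ROOT SITE OF THE BLOCK OVER `u`**: `Lc • u + toSite r` as a point of the fine box `fine Lc M` (the point at which the
rooted one-step averaging reads a gauge function — the MASTER identity's `wrapPt (p + ρ)` at `p = coarsePt u`). -/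
def rootPt (hr : r ∈ box (d + 1) Lc) (u : ↥(pbox M)) : ↥(pbox (fine Lc M)) :=
  ⟨(Lc : ℤ) • (u : Site (d + 1)) + toSite r, zsmul_add_toSite_mem_pbox_fine M Lc hr u⟩

omit [∀ μ, NeZero (M μ)] [NeZero Lc] in
/-- unfolding `rootPt`. -/
@[simp] theorem rootPt_coe (hr : r ∈ box (d + 1) Lc) (u : ↥(pbox M)) : ((rootPt M Lc hr u : ↥(pbox (fine Lc M))) : Site (d + 1)) = (Lc : ℤ) • (u : Site (d + 1)) + toSite r := rfl

omit [∀ μ, NeZero (M μ)] in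
/-- [folklore] the block index of the root site over `u` is `u`. -/
theorem quo_rootPt (hr : r ∈ box (d + 1) Lc) (u : ↥(pbox M)) : quo Lc ((rootPt M Lc hr u : ↥(pbox (fine Lc M))) : Site (d + 1)) = (u : Site (d + 1)) := by
  rw [rootPt_coe, quo_zsmul_add_toSite' hr]

/-- [folklore] the MASTER identity's evaluation points are root sites: `wrapPt (fine) (Lc•u + ρ) = rootPt u` … -/
theorem wrapPt_coarsePt_add (hr : r ∈ box (d + 1) Lc) (u : ↥(pbox M)) :
    wrapPt (fine Lc M) ((coarsePt M Lc u : Site (d + 1)) + toSite r) = rootPt M Lc hr u := wrapPt_of_mem (fine Lc M) (rootPt M Lc hr u)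

/-- [folklore] … and `wrapPt (fine) (Lc•u + ρ + Lc•e_κ) = rootPt (wrapPt M (u + e_κ))`. -/
theorem wrapPt_coarsePt_add_add (hr : r ∈ box (d + 1) Lc) (u : ↥(pbox M)) (κ : Fin (d + 1)) :
    wrapPt (fine Lc M) ((coarsePt M Lc u : Site (d + 1)) + toSite r + (Lc : ℤ) • unitVec κ)
      = rootPt M Lc hr (wrapPt M ((u : Site (d + 1)) + unitVec κ)) := by
  apply Subtype.ext
  rw [wrapPt_coe, rootPt_coe]
  refine (wrap_congr fun i => ?_).trans (wrap_eq_self (zsmul_add_toSite_mem_pbox_fine M Lc hr (wrapPt M ((u : Site (d + 1)) + unitVec κ))))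
  obtain ⟨k, hk⟩ := B6Lemma24Torus.isPeriod_sub_wrap (M := M) ((u : Site (d + 1)) + unitVec κ) i
  refine ⟨k, ?_⟩
  simp only [Pi.sub_apply, Pi.add_apply] at hk
  simp only [coarsePt_coe, wrapPt_coe, Pi.add_apply, Pi.smul_apply, smul_eq_mul, fine, Nat.cast_mul]
  linear_combination (Lc : ℤ) * hk

/-- [folklore] **THE ONE-STEP MASTER IDENTITY IN MATRIX FORM** (gan24-leaf-05's `perF_bhKStepAt_mul_tgrad_sum` on the coarse slots of (B)'s `Q₁₀`): the
rooted averaging of the torus gradient of ANY family `C` of gauge functions is `stepScale·#B` times the COARSE gradient of the family READ AT THE ROOT SITES. -/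
theorem Qstep_mul_tgrad_mul (hr : r ∈ box (d + 1) Lc) (ℓ : ℕ) {X : Type*} (C : Matrix ↥(pbox (fine Lc M)) X ℝ) :
    Qstep Lc M ℓ r * ((tgrad (fine Lc M)).submatrix (fun b : ↥(pbox (fine Lc M)) × Fin (d + 1) => ((b.1, Sum.inl b.2) : Idx (fine Lc M) (Fib d))) id * C)
      = (stepScale d Lc ℓ * ((box (d + 1) Lc).card : ℝ)) •
          ((tgrad M).submatrix (fun a : ↥(pbox M) × Fin (d + 1) => ((a.1, Sum.inl a.2) : Idx M (Fib d))) id * C.submatrix (rootPt M Lc hr) id) := by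
  ext a x
  rw [← Matrix.mul_assoc, Qstep, submatrix_field_mul (fine Lc M) _ _ (tgrad_inr (fine Lc M)), Matrix.mul_apply, Matrix.smul_apply, Matrix.mul_apply]
  simp only [Matrix.submatrix_apply, id, Matrix.mul_apply]
  rw [perF_bhKStepAt_mul_tgrad_sum (fine Lc M) hr ℓ (coarsePt M Lc a.1) a.2 (fun s => C s x), if_pos (proj_coarsePt M Lc a.1),
    wrapPt_coarsePt_add_add M Lc hr, wrapPt_coarsePt_add M Lc hr]
  simp only [tgrad_inl, sub_mul, Finset.sum_sub_distrib, sum_tdelta_mul, wrapPt_of_mem, smul_eq_mul]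
  ring

end OneStep

/-! ## §2 The iterated root map of the tower; the COMPOSITE MASTER identity -/

section Tower

variable (Lc : ℕ) [NeZero Lc]

/-- [our object — bookkeeping] **THE ITERATED ROOT MAP OF THE `n+1`-LEVEL TOWER**: `u ↦` the root site of the root site of … of its block, in the finest
torus `towerTorus Lc M n` (push-inside recursion as `towerTorus`; the first step uses the root `rs 1`, as `compRows … (n+1) = Qstep Lc M (lev 1) (rs 1) * …`). -/
def itRoot : (M : Fin (d + 1) → ℕ) → (rs : ℕ → (Fin (d + 1) → ℕ)) → (hrs : ∀ k, rs k ∈ box (d + 1) Lc) → (n : ℕ) →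
    ↥(pbox M) → ↥(pbox (towerTorus Lc M n))
  | _, _, _, 0 => id
  | M, rs, hrs, n + 1 => fun u => itRoot (fine Lc M) (fun k => rs (k + 1)) (fun k => hrs (k + 1)) n (rootPt M Lc (hrs 1) u)

omit [NeZero Lc] in
/-- unfolding, depth `0`. -/
@[simp] theorem itRoot_zero (M : Fin (d + 1) → ℕ) (rs : ℕ → (Fin (d + 1) → ℕ)) (hrs : ∀ k, rs k ∈ box (d + 1) Lc) (u : ↥(pbox M)) :
    itRoot Lc M rs hrs 0 u = u := rfl

omit [NeZero Lc] in
/-- unfolding, depth `n+1`. -/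
theorem itRoot_succ (M : Fin (d + 1) → ℕ) (rs : ℕ → (Fin (d + 1) → ℕ)) (hrs : ∀ k, rs k ∈ box (d + 1) Lc) (n : ℕ) (u : ↥(pbox M)) :
    itRoot Lc M rs hrs (n + 1) u = itRoot Lc (fine Lc M) (fun k => rs (k + 1)) (fun k => hrs (k + 1)) n (rootPt M Lc (hrs 1) u) := rfl

omit [NeZero Lc] in
/-- [folklore] nested block indices: `quo (Lc^(m+1)) x = quo Lc (quo (Lc^m) x)` (integer division by a product of non-negative divisors). -/
theorem quo_pow_succ (m : ℕ) (x : Site (d + 1)) : quo (Lc ^ (m + 1)) x = quo Lc (quo (Lc ^ m) x) := by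
  funext j; simp only [quo]; push_cast
  rw [pow_succ, Int.ediv_ediv_of_nonneg (pow_nonneg (Int.natCast_nonneg (Lc : ℕ)) m)]

/-- [folklore] **THE `Lc^n`-BLOCK INDEX OF THE ITERATED ROOT OF `u` IS `u`.** -/
theorem quo_itRoot :
    ∀ (n : ℕ) (M : Fin (d + 1) → ℕ) (rs : ℕ → (Fin (d + 1) → ℕ)) (hrs : ∀ k, rs k ∈ box (d + 1) Lc) (u : ↥(pbox M)),
      quo (Lc ^ n) ((itRoot Lc M rs hrs n u : ↥(pbox (towerTorus Lc M n))) : Site (d + 1)) = (u : Site (d + 1))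
  | 0, M, rs, hrs, u => by
    funext j
    simp only [itRoot_zero, towerTorus_zero, pow_zero, quo, Nat.cast_one, Int.ediv_one]
  | n + 1, M, rs, hrs, u => by
    have ih := quo_itRoot n (fine Lc M) (fun k => rs (k + 1)) (fun k => hrs (k + 1)) (rootPt M Lc (hrs 1) u)
    rw [quo_pow_succ, itRoot_succ]
    dsimp only [towerTorus_succ]
    rw [ih, quo_rootPt]

/-- [folklore] the COMPOSITE MASTER identity, INDUCTION STEP (top peel `compRows_succ`): the one-step MASTER on top of the identity below `fine Lc M`. -/
theorem compRows_mul_tgrad_mul_step (n : ℕ) (M : Fin (d + 1) → ℕ) [∀ μ, NeZero (M μ)] (lev : ℕ → ℕ) (rs : ℕ → (Fin (d + 1) → ℕ))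
    (hrs : ∀ k, rs k ∈ box (d + 1) Lc) {X : Type*} (C : Matrix ↥(pbox (towerTorus Lc (fine Lc M) n)) X ℝ)
    (ih : compRows Lc (fine Lc M) (fun k => lev (k + 1)) (fun k => rs (k + 1)) n
        * ((tgrad (towerTorus Lc (fine Lc M) n)).submatrix
            (fun b : ↥(pbox (towerTorus Lc (fine Lc M) n)) × Fin (d + 1) => ((b.1, Sum.inl b.2) : Idx (towerTorus Lc (fine Lc M) n) (Fib d))) id * C)
      = (∏ i ∈ range n, (stepScale d Lc (lev (i + 1 + 1)) * ((box (d + 1) Lc).card : ℝ))) •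
          ((tgrad (fine Lc M)).submatrix (fun a : ↥(pbox (fine Lc M)) × Fin (d + 1) => ((a.1, Sum.inl a.2) : Idx (fine Lc M) (Fib d))) id
            * C.submatrix (itRoot Lc (fine Lc M) (fun k => rs (k + 1)) (fun k => hrs (k + 1)) n) id)) :
    Qstep Lc M (lev 1) (rs 1) * compRows Lc (fine Lc M) (fun k => lev (k + 1)) (fun k => rs (k + 1)) n
        * ((tgrad (towerTorus Lc (fine Lc M) n)).submatrix
            (fun b : ↥(pbox (towerTorus Lc (fine Lc M) n)) × Fin (d + 1) => ((b.1, Sum.inl b.2) : Idx (towerTorus Lc (fine Lc M) n) (Fib d))) id * C)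
      = (∏ i ∈ range (n + 1), (stepScale d Lc (lev (i + 1)) * ((box (d + 1) Lc).card : ℝ))) •
          ((tgrad M).submatrix (fun a : ↥(pbox M) × Fin (d + 1) => ((a.1, Sum.inl a.2) : Idx M (Fib d))) id
            * C.submatrix (fun u => itRoot Lc (fine Lc M) (fun k => rs (k + 1)) (fun k => hrs (k + 1)) n (rootPt M Lc (hrs 1) u)) id) := by
  rw [Matrix.mul_assoc, ih, Matrix.mul_smul, Qstep_mul_tgrad_mul M Lc (hrs 1) (lev 1), smul_smul, Matrix.submatrix_submatrix, prod_range_succ']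
  rfl

/-- [folklore] **THE COMPOSITE MASTER IDENTITY**: the `n`-fold composite averaging of the finest torus's gradient of ANY family `C` of gauge functions is
`∏ (stepScale·#B)` times the TOP torus's gradient of the family READ AT THE ITERATED ROOT SITES (`Qstep_mul_tgrad_mul` iterated down the tower). -/
theorem compRows_mul_tgrad_mul :
    ∀ (n : ℕ) (M : Fin (d + 1) → ℕ) [∀ μ, NeZero (M μ)] (lev : ℕ → ℕ) (rs : ℕ → (Fin (d + 1) → ℕ)) (hrs : ∀ k, rs k ∈ box (d + 1) Lc)
      {X : Type*} (C : Matrix ↥(pbox (towerTorus Lc M n)) X ℝ),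
      compRows Lc M lev rs n
          * ((tgrad (towerTorus Lc M n)).submatrix
              (fun b : ↥(pbox (towerTorus Lc M n)) × Fin (d + 1) => ((b.1, Sum.inl b.2) : Idx (towerTorus Lc M n) (Fib d))) id * C)
        = (∏ i ∈ range n, (stepScale d Lc (lev (i + 1)) * ((box (d + 1) Lc).card : ℝ))) •
            ((tgrad M).submatrix (fun a : ↥(pbox M) × Fin (d + 1) => ((a.1, Sum.inl a.2) : Idx M (Fib d))) id * C.submatrix (itRoot Lc M rs hrs n) id)
  | 0, M, _, lev, rs, hrs, X, C => by
    dsimp only [towerTorus_zero] at C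
    show (1 : Matrix (↥(pbox M) × Fin (d + 1)) (↥(pbox M) × Fin (d + 1)) ℝ) * ((tgrad M).submatrix (fun a : ↥(pbox M) × Fin (d + 1) => ((a.1, Sum.inl a.2) : Idx M (Fib d))) id * C)
      = (∏ i ∈ range 0, (stepScale d Lc (lev (i + 1)) * ((box (d + 1) Lc).card : ℝ))) • ((tgrad M).submatrix (fun a : ↥(pbox M) × Fin (d + 1) => ((a.1, Sum.inl a.2) : Idx M (Fib d))) id * C.submatrix id id)
    rw [Matrix.one_mul, prod_range_zero, one_smul]
    rfl
  | n + 1, M, _, lev, rs, hrs, X, C =>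
    compRows_mul_tgrad_mul_step Lc n M lev rs hrs C (compRows_mul_tgrad_mul n (fine Lc M) (fun k => lev (k + 1)) (fun k => rs (k + 1)) (fun k => hrs (k + 1)) C)

end Tower

/-! ## §3 leaf-06's top generator block as «finest gradient × block indicator»; (COV-m) ORDER 0 -/

section Covariance

variable (Lc : ℕ) [NeZero Lc]

/-- [folklore] **THE TOP LEVEL's BLOCK-CONSTANT GENERATOR COLUMNS (`towerGen_succ`'s left block) ARE THE FINEST TORUS's GRADIENT TIMES THE `Lc^{n+1}`-BLOCK
INDICATOR** (`tgradBlock_eq_sum_tgrad_mul` on the iterate torus; `pboxCongr_coe` is `rfl`, so no transport along `towerTorus_fine_eq_fine`). -/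
theorem towerGen_top_eq (M : Fin (d + 1) → ℕ) [∀ μ, NeZero (M μ)] (rs : ℕ → (Fin (d + 1) → ℕ)) (n : ℕ) :
    (tgradBlock M (bigRatio Lc n)).submatrix
        (fun b : ↥(pbox (towerTorus Lc (fine Lc M) n)) × Fin (d + 1) =>
          ((pboxCongr (towerTorus_fine_eq_fine Lc M n) b.1, Sum.inl b.2) : Idx (fine (bigRatio Lc n) M) (Fib d)))
        (fun t : Res (toSite (rs 0)) Lc M => (t.1 : ↥(pbox M)))
      = (tgrad (towerTorus Lc (fine Lc M) n)).submatrix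
            (fun b : ↥(pbox (towerTorus Lc (fine Lc M) n)) × Fin (d + 1) => ((b.1, Sum.inl b.2) : Idx (towerTorus Lc (fine Lc M) n) (Fib d))) id
          * Matrix.of (fun (s : ↥(pbox (towerTorus Lc (fine Lc M) n))) (t : Res (toSite (rs 0)) Lc M) =>
              tdelta M (quo (bigRatio Lc n) (s : Site (d + 1))) t.1) := by
  haveI : NeZero (bigRatio Lc n) := ⟨(bigRatio_pos Lc (Nat.pos_of_ne_zero (NeZero.ne Lc)) n).ne'⟩
  ext ⟨b, l⟩ t
  have hper : ∀ x : Site (d + 1), tdelta M (quo (bigRatio Lc n) (wrapPt (towerTorus Lc (fine Lc M) n) x : Site (d + 1))) t.1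
      = tdelta M (quo (bigRatio Lc n) x) t.1 := fun x => by
    refine tdelta_quo_congr M (bigRatio Lc n) (fun i => ?_) t.1
    obtain ⟨k, hk⟩ := B6Lemma24Torus.isPeriod_sub_wrap (M := towerTorus Lc (fine Lc M) n) x i
    refine ⟨-k, ?_⟩
    simp only [Pi.sub_apply] at hk
    rw [towerTorus_apply] at hk
    rw [wrapPt_coe, bigRatio_eq_pow]
    simp only [fine, Nat.cast_mul, Nat.cast_pow] at hk ⊢
    linear_combination (-1 : ℤ) * hk
  simp only [Matrix.submatrix_apply, Matrix.mul_apply, Matrix.of_apply, id, tgradBlock_inl, pboxCongr_coe, tgrad_inl, sub_mul,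
    Finset.sum_sub_distrib, sum_tdelta_mul, wrapPt_of_mem, hper]

/-- [folklore] **THE BLOCK INDICATOR READ AT THE ITERATED ROOTS IS THE COLUMN SELECTOR** (`quo_itRoot`): `[quo (Lc^{n+1}) (itRoot u) ≡ t] = [u = t]`. -/
theorem blockInd_itRoot (M : Fin (d + 1) → ℕ) [∀ μ, NeZero (M μ)] (rs : ℕ → (Fin (d + 1) → ℕ)) (hrs : ∀ k, rs k ∈ box (d + 1) Lc) (n : ℕ) :
    (Matrix.of (fun (s : ↥(pbox (towerTorus Lc (fine Lc M) n))) (t : Res (toSite (rs 0)) Lc M) =>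
        tdelta M (quo (bigRatio Lc n) (s : Site (d + 1))) t.1)).submatrix
          (fun u => itRoot Lc (fine Lc M) (fun k => rs (k + 1)) (fun k => hrs (k + 1)) n (rootPt M Lc (hrs 1) u)) id
      = Matrix.of (fun (u : ↥(pbox M)) (t : Res (toSite (rs 0)) Lc M) => if u = t.1 then (1 : ℝ) else 0) := by
  ext u t
  have h := quo_itRoot Lc (n + 1) M rs hrs u
  rw [itRoot_succ] at h
  dsimp only [towerTorus_succ] at h
  simp only [Matrix.submatrix_apply, Matrix.of_apply, id]
  rw [bigRatio_eq_pow, h, TorusGaugeCovariance.tdelta_of_mem M u.2]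
  simp only [Subtype.ext_iff]

omit [NeZero Lc] in
/-- [folklore] the top torus's gradient on the field slots times the column selector `[u = t]` is the (B) `D₁ ∕ D̄`-shaped block
`tgrad M↾(fields × Res)` (= `towerGen … 0`). -/
theorem tgrad_mul_colSel (M : Fin (d + 1) → ℕ) [∀ μ, NeZero (M μ)] (r : Fin (d + 1) → ℕ) :
    (tgrad M).submatrix (fun a : ↥(pbox M) × Fin (d + 1) => ((a.1, Sum.inl a.2) : Idx M (Fib d))) id
        * Matrix.of (fun (u : ↥(pbox M)) (t : Res (toSite r) Lc M) => if u = t.1 then (1 : ℝ) else 0)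
      = (tgrad M).submatrix (fun a : ↥(pbox M) × Fin (d + 1) => ((a.1, Sum.inl a.2) : Idx M (Fib d))) (fun t : Res (toSite r) Lc M => (t.1 : ↥(pbox M))) := by
  ext a t
  rw [Matrix.mul_apply]
  simp only [Matrix.submatrix_apply, Matrix.of_apply, id, mul_ite, mul_one, mul_zero, Finset.sum_ite_eq', Finset.mem_univ, if_true]

/-- [folklore] the one-step (C1) in `Qstep` form (`NestedStepLawTorusInstance.torus_cov₁`): the rooted averaging KILLS the fine torus's gauge modes at
the residual parameters of its own comb — `Qstep · D₁ = 0`. -/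
theorem Qstep_mul_tgrad_res (M : Fin (d + 1) → ℕ) [∀ μ, NeZero (M μ)] {r : Fin (d + 1) → ℕ} (hr : r ∈ box (d + 1) Lc) (ℓ : ℕ) :
    Qstep Lc M ℓ r * (tgrad (fine Lc M)).submatrix (fun b : ↥(pbox (fine Lc M)) × Fin (d + 1) => ((b.1, Sum.inl b.2) : Idx (fine Lc M) (Fib d)))
        (fun t : Res (toSite r) Lc (fine Lc M) => (t.1 : ↥(pbox (fine Lc M)))) = 0 :=
  NestedStepLawTorusInstance.torus_cov₁ M hr ℓ

/-- [folklore] (C1) against a LOWER tower's descended block `[σ • D̄′ | 0]`: the rooted averaging of `M ← fine Lc M` kills it entirely (any scalar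
`σ`, any lower parameter type `Y`). -/
theorem Qstep_mul_fromCols_smul_tgrad_res (M : Fin (d + 1) → ℕ) [∀ μ, NeZero (M μ)] {r : Fin (d + 1) → ℕ} (hr : r ∈ box (d + 1) Lc) (ℓ : ℕ)
    (σ : ℝ) (Y : Type*) :
    Qstep Lc M ℓ r * Matrix.fromCols
        (σ • (tgrad (fine Lc M)).submatrix (fun b : ↥(pbox (fine Lc M)) × Fin (d + 1) => ((b.1, Sum.inl b.2) : Idx (fine Lc M) (Fib d)))
          (fun t : Res (toSite r) Lc (fine Lc M) => (t.1 : ↥(pbox (fine Lc M)))))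
        (0 : Matrix (↥(pbox (fine Lc M)) × Fin (d + 1)) Y ℝ) = 0 := by
  rw [Matrix.mul_fromCols, Matrix.mul_smul, Qstep_mul_tgrad_res Lc M hr ℓ, smul_zero, Matrix.mul_zero, Matrix.fromCols_zero]

/-- [folklore] the one-step (C2) in `Qstep` form (`NestedStepLawTorusInstance.torus_cov₂`, gan24-leaf-05's MASTER-COARSE): the rooted averaging DESCENDS
the block-constant modes to `stepScale·#B` times the coarse torus's gradients — `Qstep · D₂ = (stepScale·#B) • D̄`. -/
theorem Qstep_mul_tgradBlock_res (M : Fin (d + 1) → ℕ) [∀ μ, NeZero (M μ)] {r : Fin (d + 1) → ℕ} (hr : r ∈ box (d + 1) Lc) (ℓ : ℕ)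
    (r' : Fin (d + 1) → ℕ) :
    Qstep Lc M ℓ r * (tgradBlock M Lc).submatrix (fun b : ↥(pbox (fine Lc M)) × Fin (d + 1) => ((b.1, Sum.inl b.2) : Idx (fine Lc M) (Fib d)))
        (fun t : Res (toSite r') Lc M => (t.1 : ↥(pbox M)))
      = (stepScale d Lc ℓ * ((box (d + 1) Lc).card : ℝ)) • (tgrad M).submatrix (fun a : ↥(pbox M) × Fin (d + 1) => ((a.1, Sum.inl a.2) : Idx M (Fib d))) (fun t : Res (toSite r') Lc M => (t.1 : ↥(pbox M))) := by
  ext a t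
  have h := congrFun (congrFun (NestedStepLawTorusInstance.torus_cov₂ M hr ℓ (r' := r')) a) t
  rw [Matrix.of_apply] at h
  rw [Matrix.smul_apply, Matrix.submatrix_apply, smul_eq_mul]
  exact h.trans (by ring)

/-- [folklore] **(COV-m) ORDER 0 AT DEPTH ONE, one-step form**: `Qstep · [D₂ | D₁] = [(stepScale·#B) • D̄ | 0]` (`towerGen_one`'s blocks). -/
theorem Qstep_mul_fromCols (M : Fin (d + 1) → ℕ) [∀ μ, NeZero (M μ)] (lev : ℕ → ℕ) (rs : ℕ → (Fin (d + 1) → ℕ))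
    (hrs : ∀ k, rs k ∈ box (d + 1) Lc) :
    Qstep Lc M (lev 1) (rs 1) * Matrix.fromCols
        ((tgradBlock M Lc).submatrix (fun b : ↥(pbox (fine Lc M)) × Fin (d + 1) => ((b.1, Sum.inl b.2) : Idx (fine Lc M) (Fib d)))
          (fun t : Res (toSite (rs 0)) Lc M => (t.1 : ↥(pbox M))))
        ((tgrad (fine Lc M)).submatrix (fun b : ↥(pbox (fine Lc M)) × Fin (d + 1) => ((b.1, Sum.inl b.2) : Idx (fine Lc M) (Fib d)))
          (fun t : Res (toSite (rs 1)) Lc (fine Lc M) => (t.1 : ↥(pbox (fine Lc M)))))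
      = Matrix.fromCols
          ((∏ i ∈ range 1, (stepScale d Lc (lev (i + 1)) * ((box (d + 1) Lc).card : ℝ))) •
            (tgrad M).submatrix (fun a : ↥(pbox M) × Fin (d + 1) => ((a.1, Sum.inl a.2) : Idx M (Fib d))) (fun t : Res (toSite (rs 0)) Lc M => (t.1 : ↥(pbox M))))
          (0 : Matrix (↥(pbox M) × Fin (d + 1)) (Res (toSite (rs 1)) Lc (fine Lc M)) ℝ) := by
  rw [Matrix.mul_fromCols, Qstep_mul_tgradBlock_res Lc M (hrs 1), Qstep_mul_tgrad_res Lc M (hrs 1), prod_range_one, zero_add]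

/-- [folklore] **(COV-m) ORDER 0 AT DEPTH ONE** = the one-step `c0` (`compRows_one ∕ towerGen_one`). -/
theorem compRows_mul_towerGen_one (M : Fin (d + 1) → ℕ) [∀ μ, NeZero (M μ)] (lev : ℕ → ℕ) (rs : ℕ → (Fin (d + 1) → ℕ))
    (hrs : ∀ k, rs k ∈ box (d + 1) Lc) :
    compRows Lc M lev rs 1 * towerGen Lc M rs 1
      = Matrix.fromCols
          ((∏ i ∈ range 1, (stepScale d Lc (lev (i + 1)) * ((box (d + 1) Lc).card : ℝ))) •
            (tgrad M).submatrix (fun a : ↥(pbox M) × Fin (d + 1) => ((a.1, Sum.inl a.2) : Idx M (Fib d))) (fun t : Res (toSite (rs 0)) Lc M => (t.1 : ↥(pbox M))))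
          (0 : Matrix (↥(pbox M) × Fin (d + 1)) (NParam Lc (fine Lc M) (fun k => rs (k + 1)) 0) ℝ) := by
  rw [compRows_one]
  exact Qstep_mul_fromCols Lc M lev rs hrs

/-- [folklore] **(COV-m) ORDER 0, THE INDUCTION STEP** (top peel `compRows_succ ∕ towerGen_succ`): if the `(n+1)`-fold composite below `fine Lc M` sends its
tower generators to `[σ′ • D̄′ | 0]`, one more step on top gives `[σ′·stepScale(lev 1)·#B • D̄ | 0]` — lower block: `Qstep` kills `D̄′` ((C1)); top block: the
COMPOSITE MASTER identity against `towerGen_top_eq`, then the one-step MASTER, `blockInd_itRoot`, `tgrad_mul_colSel`. -/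
theorem compRows_mul_towerGen_step (n : ℕ) (M : Fin (d + 1) → ℕ) [∀ μ, NeZero (M μ)] (lev : ℕ → ℕ) (rs : ℕ → (Fin (d + 1) → ℕ))
    (hrs : ∀ k, rs k ∈ box (d + 1) Lc)
    (ih : compRows Lc (fine Lc M) (fun k => lev (k + 1)) (fun k => rs (k + 1)) (n + 1) * towerGen Lc (fine Lc M) (fun k => rs (k + 1)) (n + 1)
      = Matrix.fromCols
          ((∏ i ∈ range (n + 1), (stepScale d Lc (lev (i + 1 + 1)) * ((box (d + 1) Lc).card : ℝ))) •
            (tgrad (fine Lc M)).submatrix (fun a : ↥(pbox (fine Lc M)) × Fin (d + 1) => ((a.1, Sum.inl a.2) : Idx (fine Lc M) (Fib d)))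
              (fun t : Res (toSite (rs 1)) Lc (fine Lc M) => (t.1 : ↥(pbox (fine Lc M)))))
          (0 : Matrix (↥(pbox (fine Lc M)) × Fin (d + 1)) (NParam Lc (fine Lc (fine Lc M)) (fun k => rs (k + 1 + 1)) n) ℝ)) :
    Qstep Lc M (lev 1) (rs 1) * compRows Lc (fine Lc M) (fun k => lev (k + 1)) (fun k => rs (k + 1)) (n + 1)
        * Matrix.fromCols
            ((tgradBlock M (bigRatio Lc (n + 1))).submatrix
              (fun b : ↥(pbox (towerTorus Lc (fine Lc M) (n + 1))) × Fin (d + 1) =>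
                ((pboxCongr (towerTorus_fine_eq_fine Lc M (n + 1)) b.1, Sum.inl b.2) : Idx (fine (bigRatio Lc (n + 1)) M) (Fib d)))
              (fun t : Res (toSite (rs 0)) Lc M => (t.1 : ↥(pbox M))))
            (towerGen Lc (fine Lc M) (fun k => rs (k + 1)) (n + 1))
      = Matrix.fromCols
          ((∏ i ∈ range (n + 1 + 1), (stepScale d Lc (lev (i + 1)) * ((box (d + 1) Lc).card : ℝ))) •
            (tgrad M).submatrix (fun a : ↥(pbox M) × Fin (d + 1) => ((a.1, Sum.inl a.2) : Idx M (Fib d))) (fun t : Res (toSite (rs 0)) Lc M => (t.1 : ↥(pbox M))))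
          (0 : Matrix (↥(pbox M) × Fin (d + 1)) (NParam Lc (fine Lc M) (fun k => rs (k + 1)) (n + 1)) ℝ) := by
  have hσ : (∏ i ∈ range (n + 1), (stepScale d Lc (lev (i + 1 + 1)) * ((box (d + 1) Lc).card : ℝ))) * (stepScale d Lc (lev 1) * ((box (d + 1) Lc).card : ℝ))
      = ∏ i ∈ range (n + 1 + 1), (stepScale d Lc (lev (i + 1)) * ((box (d + 1) Lc).card : ℝ)) := by
    rw [prod_range_succ' _ (n + 1)]
  -- the lower block: `Qstep` kills the lower tower's descended modes (read `ih` through `Qstep ·` at the tower's own parameter type)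
  have low : Qstep Lc M (lev 1) (rs 1)
      * (compRows Lc (fine Lc M) (fun k => lev (k + 1)) (fun k => rs (k + 1)) (n + 1) * towerGen Lc (fine Lc M) (fun k => rs (k + 1)) (n + 1)) = 0 :=
    (congrArg (fun X => Qstep Lc M (lev 1) (rs 1) * X) ih).trans
      (Qstep_mul_fromCols_smul_tgrad_res Lc M (hrs 1) (lev 1) _ (NParam Lc (fine Lc (fine Lc M)) (fun k => rs (k + 1 + 1)) n))
  have cm := compRows_mul_tgrad_mul Lc (n + 1) (fine Lc M) (fun k => lev (k + 1)) (fun k => rs (k + 1)) (fun k => hrs (k + 1))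
    (Matrix.of (fun (s : ↥(pbox (towerTorus Lc (fine Lc M) (n + 1)))) (t : Res (toSite (rs 0)) Lc M) =>
      tdelta M (quo (bigRatio Lc (n + 1)) (s : Site (d + 1))) t.1))
  rw [Matrix.mul_assoc, Matrix.mul_fromCols, Matrix.mul_fromCols, low, towerGen_top_eq, cm, Matrix.mul_smul,
    Qstep_mul_tgrad_mul M Lc (hrs 1) (lev 1), smul_smul, Matrix.submatrix_submatrix, Function.comp_id, hσ]
  rw [show (itRoot Lc (fine Lc M) (fun k => rs (k + 1)) (fun k => hrs (k + 1)) (n + 1)) ∘ (rootPt M Lc (hrs 1))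
      = fun u => itRoot Lc (fine Lc M) (fun k => rs (k + 1)) (fun k => hrs (k + 1)) (n + 1) (rootPt M Lc (hrs 1) u) from rfl,
    blockInd_itRoot, tgrad_mul_colSel]

/-- [folklore] **(COV-m) ORDER 0 — THE COMPOSITE COVARIANCE ROW `c0` AT EVERY DEPTH**: the `(n+1)`-fold composite averaging KILLS every lower level's
gauge mode and DESCENDS the top block-constant modes to `σ_{n+1} ×` the top torus's gradients at the top comb's residual parameters — `D̄ := tgrad
M↾(fields × Res (toSite (rs 0)))` (the (B) `D̄` shape = `towerGen … 0`), `σ_{n+1} = ∏_{i ≤ n} stepScale d Lc (lev (i+1)) · #B` DISPLAYED.  The OWNER d1-p3's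
composite call `c0` with `Dbar := σ_{n+1} • D̄` (`compRows_mul_towerGen_one` iterated by `compRows_mul_towerGen_step`). -/
theorem compRows_mul_towerGen_succ :
    ∀ (n : ℕ) (M : Fin (d + 1) → ℕ) [∀ μ, NeZero (M μ)] (lev : ℕ → ℕ) (rs : ℕ → (Fin (d + 1) → ℕ)) (hrs : ∀ k, rs k ∈ box (d + 1) Lc),
      compRows Lc M lev rs (n + 1) * towerGen Lc M rs (n + 1)
        = Matrix.fromCols
            ((∏ i ∈ range (n + 1), (stepScale d Lc (lev (i + 1)) * ((box (d + 1) Lc).card : ℝ))) •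
              (tgrad M).submatrix (fun a : ↥(pbox M) × Fin (d + 1) => ((a.1, Sum.inl a.2) : Idx M (Fib d))) (fun t : Res (toSite (rs 0)) Lc M => (t.1 : ↥(pbox M))))
            (0 : Matrix (↥(pbox M) × Fin (d + 1)) (NParam Lc (fine Lc M) (fun k => rs (k + 1)) n) ℝ)
  | 0, M, _, lev, rs, hrs => compRows_mul_towerGen_one Lc M lev rs hrs
  | n + 1, M, _, lev, rs, hrs =>
    compRows_mul_towerGen_step Lc n M lev rs hrs (compRows_mul_towerGen_succ n (fine Lc M) (fun k => lev (k + 1)) (fun k => rs (k + 1)) (fun k => hrs (k + 1)))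

/-- [folklore] **(COV-m) ORDER 0 — THE TOP STEP's COARSE COVARIANCE ROW `d0`**: the top step's averaging rows (level `ℓ`, root `r`, coarse multiplier slots
`a ↦ (pμ′ a, inr (mμ′ a))` of `M`) KILL `σ • D̄` ((C1) one level up, `torus_cov₀'` shape; any `σ`; `Lc ∣ M i`) — the OWNER's `d0` with `Dbar := σ_{n+1} • D̄`. -/
theorem Qtop_mul_smul_tgrad_res (M : Fin (d + 1) → ℕ) [∀ μ, NeZero (M μ)] {r : Fin (d + 1) → ℕ} (hr : r ∈ box (d + 1) Lc) (hM : ∀ i, Lc ∣ M i)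
    (ℓ : ℕ) (σ : ℝ) {κ : Type*} (pμ' : κ → ↥(pbox M)) (mμ' : κ → Fin (d + 1)) :
    (perF M (bhKStepAt d (toSite r) Lc ℓ)).submatrix (fun a : κ => ((pμ' a, Sum.inr (mμ' a)) : Idx M (Fib d)))
          (fun b : ↥(pbox M) × Fin (d + 1) => ((b.1, Sum.inl b.2) : Idx M (Fib d)))
        * (σ • (tgrad M).submatrix (fun a : ↥(pbox M) × Fin (d + 1) => ((a.1, Sum.inl a.2) : Idx M (Fib d))) (fun t : Res (toSite r) Lc M => (t.1 : ↥(pbox M))))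
      = 0 := by
  rw [Matrix.mul_smul, submatrix_field_mul M _ _ (tgrad_inr M)]
  convert smul_zero σ
  ext a t
  rw [Matrix.submatrix_apply, Matrix.mul_apply, Matrix.zero_apply]
  exact TorusGaugeCovariance.perF_bhKStepAt_mul_tgrad_of_not_root M hr hM ℓ _ (mμ' a)
    ((TorusCombRows.ne_rootOf_iff_proj_ne (Nat.pos_of_ne_zero (NeZero.ne Lc)) (toSite_mem_range hr) _).1 t.2)

end Covariance

end Summit.QuantumFields.BalabanUV.Beta.FP.TorusCompositeCovariance

end
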